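import Summits.QuantumFields.BalabanUV.Beta.EriceFlowEnclosureB12AsPrintedPointwiseHistory

/-!
# Beta / EriceFlowEnclosureB12AsPrintedPointwiseHistoryWitness — WHAT (0.31) FORCES POINTWISE, witness part 4b: IN THE HISTORY READING, UNIQUENESS IS NOT ENOUGH — THE
# MARKOV LETTER OF PART 1 IS LOAD-BEARING.  The def-free toy SETTING of [I] as typed carrying part 4a's two-coupling family (`…PointwiseHistory`): [I]'s WHOLE typed content,
# (0.31) with g-UNIFORM constants and Theorem 2 AS TYPED, UNIQUENESS of the in-interval run with given (K, m, endpoint), (U), (C), p. 264's clause, `hrg` — EVERY hypothesis of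
# part 1's `betaSignH_of_theorem2_markov` with «Markov + injective one-step maps» replaced by uniqueness itself — yet the Markov letter fails and ¬`FlowStep.BetaSignH`: positivity
# AT RUN HISTORIES (part 1 §1 `lastStep_pos_of_unique`) is all the history reading gives (β-flow team, prover 2 = lower ∕ positivity side, unit `b2b-balaban-beta-bflow-p2`, gen 42;
# ROW AP-I × ROW U)

HONEST FRAMING (page 1 of everything the β sub-cell writes): discharging `BetaPertH` makes Bałaban's UV stability UNCONDITIONAL — a
real constructive-QFT result; it is NOT the continuum limit and NOT the Clay problem.  HONEST DEPENDENCY (cell reorg 2026-08-19,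
verbatim): «continuum YM on T⁴ ⇐ BetaPertH ∧ nine spine estimates (0/9 proved); BetaPertH ⇐ (D1) ∧ (D4) ∧ CAP+tail; G-an2-4 gates
asym, D1 and NE2/3/4.»  THIS MODULE DISCHARGES NOTHING and says NOTHING about Bałaban's objects: ONE toy setting (ours) of `B12BetaAsPrinted` ([Balaban1987RG1] as typed,
p537882 ✓ ∕ v1.1–v1.3), slots filled with prover 1's toy kernels β·Re Q_{νμ}; `Theorem2Statement` (STATED WITHOUT PROOF, p. 259) is PROVED FOR THE TOY.

WHAT THIS FILE PROVES (0 sorry, 0 def): `histToy_exists` (def-free SETTING, L = 13, γ = ½: `StandingHypotheses ∧ Definitions ∧ Conclusions` ∧ ¬`BetaSignH` — (0.20)'s forward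
determination `d020` by part 4a's `beta_cpl_prefix_eq_one` + prover 1's `natRec_run_step`, (2.13)'s `d213` by `beta_of_last_zero`, p. 264's clause by `letters_hist`, the rest by the
toy-kernel lemmas with c := β_{j+1}(history), |c| ≤ 1); HEADLINE **`sign_not_forced_in_history_reading`** (∃ S hH: typed content ∧ g-uniform (0.31) ∧ `Theorem2Statement` ∧ uniqueness ∧
(U)(C)(264)`hrg` on ]0, ½] ∧ ¬Markov ∧ ¬`BetaSignH`); **`not_betaSignH_of_theorem2_unique_schema`** (part 1's END with «Markov + injective» replaced by uniqueness is FALSE as a schema).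
NOT CLAIMED: that the toy resembles Bałaban's (1.22); any letter for it; Theorem 2; `BetaPertH`; continuum; Clay.
-/

namespace Summit.QuantumFields.BalabanUV.Beta.EriceFlowEnclosureB12AsPrintedPointwiseHistoryWitness

open Filter Set
open scoped Topology
open Real (smoothTransition)
open Literature.MathematicalPhysics.QuantumFieldTheory.Balaban1983to89
open Literature.MathematicalPhysics.QuantumFieldTheory.Balaban1983to89.B12Rep537 (wilsonQ MQ MQ_nonneg)
open Literature.MathematicalPhysics.QuantumFieldTheory.Balaban1983to89.B12BetaAsPrinted
open Literature.MathematicalPhysics.QuantumFieldTheory.Balaban1983to89.B12CouplingClausesHistory (BetaSmoothInLast264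
  betaDerivsBoundedInLast264_of_smooth)
open Literature.MathematicalPhysics.QuantumFieldTheory.Balaban1983to89.FlowStep (prefixOf Box mem_box BetaContH BetaLowerH BetaUpperH
  BetaSignH RGEqH inv_sq_telescopeH)
open Summit.QuantumFields.BalabanUV.Beta.EriceFlowEnclosureB12AsPrintedMarginal
open Summit.QuantumFields.BalabanUV.Beta.EriceFlowEnclosureB12AsPrintedWitness
open Summit.QuantumFields.BalabanUV.Beta.EriceFlowEnclosureB12AsPrintedEriceRunWitness (c537_of_const)
open Summit.QuantumFields.BalabanUV.Beta.EriceFlowEnclosureB12AsPrintedPointwiseUniform (theorem2Statement_of_uniform)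
open Summit.QuantumFields.BalabanUV.Beta.EriceFlowEnclosureB12AsPrintedPointwiseDip
open Summit.QuantumFields.BalabanUV.Beta.EriceFlowEnclosureB12AsPrintedPointwiseWitness (cpl_eq_of_rgEqH)

open Summit.QuantumFields.BalabanUV.Beta.EriceFlowEnclosureB12AsPrintedPointwiseHistory

noncomputable section

section Family

variable {D : ℕ → ℝ → ℝ}
  (hDip : ∀ (k : ℕ) (y : ℝ), D k y = smoothTransition (2 * (y - ((k : ℝ) + 4))) * smoothTransition (2 * (((k : ℝ) + 4) + 1 - y)))
include hDip

/-! ## §2 The def-free toy setting and the headline -/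

/-- **THE TWO-COUPLING TOY** (fields as part 5's `bumpToy_exists`): L = 13, γ = ½, β as `hβ`, runs = forward solutions with unit increments, kernels β_{j+1}·Re Q_{νμ};
`StandingHypotheses ∧ Definitions ∧ Conclusions` of [I] as typed hold — (0.20)'s forward determination `d020` by `beta_cpl_prefix_eq_one` + prover 1's `natRec_run_step`, (2.13)'s `d213`
by `beta_of_last_zero`, p. 264's clause by `letters_hist`, the rest by the toy-kernel lemmas with c := β_{j+1}(history) (|c| ≤ 1) — and ¬`BetaSignH S.β`. [folklore] -/
theorem histToy_exists : ∃ S : Setting,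
    (∀ (k : ℕ) (p : Fin (k + 1) → ℝ), S.β k p = if p (Fin.last k) = 0 then 1 else
      1 - 3 / 2 * D 0 (1 / (p ⟨k - 1, Nat.lt_succ_of_le (Nat.sub_le k 1)⟩) ^ 2 - 1 / (p (Fin.last k)) ^ 2 + 4)) ∧
    S.L = 13 ∧ S.γ = 1 / 2 ∧ StandingHypotheses S ∧ Definitions S ∧ Conclusions S ∧ ¬ BetaSignH S.β := by
  let B : FlowStep.HBeta := fun k p => if p (Fin.last k) = 0 then 1 else
      1 - 3 / 2 * D 0 (1 / (p ⟨k - 1, Nat.lt_succ_of_le (Nat.sub_le k 1)⟩) ^ 2 - 1 / (p (Fin.last k)) ^ 2 + 4)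
  let S : Setting := ⟨13, True, 1,
      fun P k => Nat.rec (motive := fun _ => ℝ) P.g0 (fun (_ : ℕ) (g : ℝ) => 1 / Real.sqrt (1 / g ^ 2 - 1)) k,
      B, 1 / 2, 1, 1, fun _ => Unit, fun _ => (), fun _ _ => 0, fun j p _ => B j p, fun j p _ => B j p,
      fun _ F E => |F ()| ≤ E, 1, 1, 1, fun _ => 1,
      fun _ F => fun μ ν x => F () * (wilsonQ ν μ x).re,
      fun j p => fun μ ν x => B j p * (wilsonQ ν μ x).re, 1, fun _ _ => True, 1, False, fun j p => B j p, 1, 1, MQ 1 4, 1⟩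
  have hβS : ∀ (k : ℕ) (p : Fin (k + 1) → ℝ), S.β k p = if p (Fin.last k) = 0 then 1 else
      1 - 3 / 2 * D 0 (1 / (p ⟨k - 1, Nat.lt_succ_of_le (Nat.sub_le k 1)⟩) ^ 2 - 1 / (p (Fin.last k)) ^ 2 + 4) := fun _ _ => rfl
  have hcplS : ∀ (P : B12.RunParams) (k : ℕ), S.cpl P k =
      Nat.rec (motive := fun _ => ℝ) P.g0 (fun (_ : ℕ) (g : ℝ) => 1 / Real.sqrt (1 / g ^ 2 - 1)) k := fun _ _ => rfl
  have habs : ∀ (j : ℕ) (p : Fin (j + 1) → ℝ), |B j p| ≤ 1 := fun j p => (beta_mem hDip hβS j p).2.2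
  have hH : StandingHypotheses S :=
    { hL := by show Odd 13 ∧ 11 < 13; exact ⟨⟨6, by norm_num⟩, by norm_num⟩, hG := trivial, hκ₀ := by norm_num, hMκ := by norm_num,
      hγ := by norm_num, hε₀ := by norm_num, hε₁ := by norm_num, hα₀ := by norm_num, hα₁ := by norm_num, hκ := by norm_num, hM := by norm_num }
  have hD : Definitions S := by
    refine { d018 := fun P => rfl, d020 := ?_, d13 := ?_, d213 := ?_, d214 := ?_, d120 := ?_, d120split := ?_, d121 := ?_, d122 := ?_ }
    · intro P k _ hpos hrhs
      have h1 : S.β k (prefixOf (S.cpl P) k) = 1 := beta_cpl_prefix_eq_one hDip hβS hcplS P hpos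
      rw [h1] at hrhs ⊢
      exact natRec_run_step P.g0 (fun (_ : ℕ) (_ : ℝ) => (1 : ℝ)) k hrhs
    · intro j p U; show B j p - B j p = (0 - 0) + (B j p - B j p); ring
    · intro k p p' hp hp'
      funext u
      show S.β k p = S.β k p'
      rw [beta_of_last_zero hβS k hp, beta_of_last_zero hβS k hp']
    · intro k p; rfl
    · intro j p; rfl
    · intro j p; funext μ ν x
      show B j p * (wilsonQ ν μ x).re = 0 * (wilsonQ ν μ x).re + B j p * (wilsonQ ν μ x).re; ring
    · intro j p
      refine ⟨fun σ μ ν x => ?_, fun ε hε μ ν z => reflect_toyKernel _ hε μ ν z, fun μ ν z => ?_⟩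
      · show B j p * (wilsonQ (σ ν) (σ μ) (x ∘ σ.symm)).re = B j p * (wilsonQ ν μ x).re
        rw [wilsonQ_perm]
      · show B j p * (wilsonQ ν μ z).re = B j p * (wilsonQ μ ν (-z)).re
        rw [wilsonQ_neg_transpose ν μ z]
    · intro j p _ μ ν hμν
      exact ⟨(fourier_toyKernel hμν _).symm, (secondMoment_toyKernel hμν _).symm⟩
  obtain ⟨-, -, hsm, -⟩ := letters_hist hDip hβS hD
  have hC : Conclusions S := by
    refine { c13 := fun _ _ _ _ => trivial, c118 := fun _ _ j _ s _ => ⟨habs j _, habs j _⟩, c264 := ?_, c510 := ?_, c537 := ?_ }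
    · intro P hP j hj
      refine ⟨fun n => smooth264_of_box hsm hP.inInterval hj n, fun hflag => (hflag : False).elim, fun n => ?_⟩
      exact derivBound264_of_box (betaDerivsBoundedInLast264_of_smooth (by norm_num) hsm) hP.inInterval hj n
    · refine ⟨by norm_num, fun j F E hF μ ν x => ?_⟩
      have hF' : |F ()| ≤ E := hF
      show |F () * (wilsonQ ν μ x).re| ≤ MQ 1 4 * E * Real.exp (-1 * B12Sec2to5.l1 x)
      calc |F () * (wilsonQ ν μ x).re| ≤ |F ()| * MQ 1 4 * Real.exp (-1 * B12Sec2to5.l1 x) := decay510_toyKernel (d := 4) (F ()) μ ν x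
        _ ≤ E * MQ 1 4 * Real.exp (-1 * B12Sec2to5.l1 x) :=
            mul_le_mul_of_nonneg_right (mul_le_mul_of_nonneg_right hF' (MQ_nonneg 1 4)) (Real.exp_pos _).le
        _ = MQ 1 4 * E * Real.exp (-1 * B12Sec2to5.l1 x) := by ring
    · intro P _ j _ s _ μ ν
      exact c537_of_const _ (habs j _) μ ν
  exact ⟨S, hβS, rfl, rfl, hH, hD, hC, (uniformTheorem2_not_betaSignH_hist hDip hβS hH hD).2.2⟩

end Family


/-- **IN THE HISTORY READING, UNIQUENESS DOES NOT MAKE (0.31) SPEAK BOX-WIDE.**  There is a setting `S` of [I] as typed with: [I]'s WHOLE typed content (hence `B12BetaAsPrinted S`);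
(0.31) in cpl-form with g-UNIFORM constants and [I] THEOREM 2 AS TYPED; UNIQUENESS of the in-interval run with given (K, m, endpoint) on ]0, ½] («g₀ = g₀(ε, g)» is a function); (U)
`BetaUpperH 1 (1∕2) S.β`, (C) `BetaContH (1∕2) S.β`, p. 264's clause box-wide, the binder `hrg` on ]0, ½] — i.e. EVERY hypothesis of part 1's `betaSignH_of_theorem2_markov` with
«Markov + injective one-step maps» replaced by UNIQUENESS itself — and: the Markov letter FAILS, **¬`BetaSignH S.β`**.  (β_{k+1} depends on (g_{k−1}, g_k) — p. 298's sentence.)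
So part 1 §1's `lastStep_pos_of_unique` — positivity AT RUN HISTORIES — is exactly what the history reading gives; the box-wide sign needs the Markov letter.
[cite: Balaban1987RG1, Thm 2 (0.31) p.259, (0.20) p.256 and p.298] -/
theorem sign_not_forced_in_history_reading :
    ∃ (S : Setting) (hH : StandingHypotheses S), Definitions S ∧ Conclusions S ∧ B12BetaAsPrinted S ∧
      (∀ m : ℕ, ∃ γ₀ : ℝ, 0 < γ₀ ∧ ∀ γ : ℝ, 0 < γ → γ ≤ γ₀ → ∃ g₁ : ℝ, 0 < g₁ ∧ ∃ β β' : ℝ, 0 < β ∧ β ≤ β' ∧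
        ∀ g : ℝ, 0 < g → g ≤ g₁ → ∀ K : ℕ, ∃ g₀ : ℝ, Step.InInterval γ K (S.cpl ⟨K, m, g₀⟩) ∧ S.cpl ⟨K, m, g₀⟩ K = g ∧
          Step.Discrete031 (β * Real.log S.L) (β' * Real.log S.L) K g (S.cpl ⟨K, m, g₀⟩)) ∧
      Theorem2Statement S (hL_of_standing hH) ∧
      (∀ (K m : ℕ) (g₀ g₀' : ℝ), Step.InInterval (1 / 2) K (S.cpl ⟨K, m, g₀⟩) → Step.InInterval (1 / 2) K (S.cpl ⟨K, m, g₀'⟩) →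
        S.cpl ⟨K, m, g₀⟩ K = S.cpl ⟨K, m, g₀'⟩ K → g₀ = g₀') ∧
      BetaUpperH 1 (1 / 2) S.β ∧ BetaContH (1 / 2) S.β ∧ BetaSmoothInLast264 (1 / 2) S.β ∧
      (∀ P : B12.RunParams, Step.InInterval (1 / 2) P.K (S.cpl P) → RGEqH P.K S.β (S.cpl P)) ∧
      (¬ ∀ (k : ℕ) (p q : Fin (k + 1) → ℝ), p (Fin.last k) = q (Fin.last k) → S.β k p = S.β k q) ∧
      ¬ BetaSignH S.β := by
  have hDip : ∀ (k : ℕ) (y : ℝ), (fun (k : ℕ) (y : ℝ) => smoothTransition (2 * (y - ((k : ℝ) + 4))) *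
      smoothTransition (2 * (((k : ℝ) + 4) + 1 - y))) k y =
      smoothTransition (2 * (y - ((k : ℝ) + 4))) * smoothTransition (2 * (((k : ℝ) + 4) + 1 - y)) := fun _ _ => rfl
  obtain ⟨S, hβ, -, -, hH, hD, hC, hnS⟩ := histToy_exists hDip
  obtain ⟨hU, hCt, hSm, hrg⟩ := letters_hist hDip hβ hD
  obtain ⟨hTu, hT, -⟩ := uniformTheorem2_not_betaSignH_hist hDip hβ hH hD
  exact ⟨S, hH, hD, hC, fun _ _ => hC, hTu, hT, fun K m g₀ g₀' hI hI' hend => unique_hist hDip hβ hD hrg K m g₀ g₀' hI hI' hend,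
    hU, hCt, hSm, hrg, not_markov_hist hDip hβ, hnS⟩

/-- **PART 1's END WITH «MARKOV + INJECTIVE ONE-STEP MAPS» REPLACED BY UNIQUENESS IS FALSE AS A SCHEMA**: «[I]'s typed content + Theorem 2 as typed + uniqueness of the in-interval
run with given (K, m, endpoint) on ]0, γ] + (U) + `hrg` on ]0, γ] ⟹ `BetaSignH S.β`» fails (γ = ½, the two-coupling toy). [cite: Balaban1987RG1, Thm 2 (0.31) p.259 and p.298] -/
theorem not_betaSignH_of_theorem2_unique_schema :
    ¬ ∀ (S : Setting) (hH : StandingHypotheses S), Definitions S → Conclusions S → Theorem2Statement S (hL_of_standing hH) →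
        ∀ γ : ℝ, 0 < γ →
          (∀ (K m : ℕ) (g₀ g₀' : ℝ), Step.InInterval γ K (S.cpl ⟨K, m, g₀⟩) → Step.InInterval γ K (S.cpl ⟨K, m, g₀'⟩) →
            S.cpl ⟨K, m, g₀⟩ K = S.cpl ⟨K, m, g₀'⟩ K → g₀ = g₀') →
          BetaUpperH 1 γ S.β → (∀ P : B12.RunParams, Step.InInterval γ P.K (S.cpl P) → RGEqH P.K S.β (S.cpl P)) → BetaSignH S.β := by
  intro h
  obtain ⟨S, hH, hD, hC, -, -, hT, huniq, hU, -, -, hrg, -, hnot⟩ := sign_not_forced_in_history_reading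
  exact hnot (h S hH hD hC hT (1 / 2) (by norm_num) huniq hU hrg)

end

end Summit.QuantumFields.BalabanUV.Beta.EriceFlowEnclosureB12AsPrintedPointwiseHistoryWitness
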